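import Mathlib
import HarnessLib
import HarnessLib.Audit
import Summits.FinalStateConjecture.Statement
import Summits.FinalStateConjecture.FinalStateConjecture.Theorems.ProbeNullTraceAssemblyFrame

/-!
Route: ProbeNullTrace

DORMANT since 2026-09-04T18:34:00Z (reconciler: no traction for 5 d (last activity statement-checked at 2026-08-30T17:44:34Z); parked, not closed — `ledger route dormant route-FinalStateConjecture-ProbeNullTrace --off` to reactivate) — unstaffed, not closed; items shared with open routes are served there. `ledger route dormant <id> --off` reactivates.

# Route ProbeNullTrace — per-datum Sard — a tame admissible finite-dimensional probe whose punctured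
exceptional trace is (k−1)-null up to finitely many walls pierces to a tame Christodoulou curve

It suffices to show X = C ∧ S ∧ M, a PER-DATUM, FINITE-DIMENSIONAL, MEASURE-THEORETIC form of
Christodoulou's TAME genericity
(card prevalence-universal-pulse-probe, assembly (b): "prevalence + smooth/small traces ⇒ the typed
summit"), re-glued 2026-08-16 for the
re-typed Statement (p126844: `IsTameChristodoulouGeneric` on one fixed end, honest near-zone radii,
`RaysStayInClosure`, `IsFutureOriented`).
Call a jointly smooth injective k-parameter family Φ : ℝᵏ → admissibleVacuumData X with Φ(0) = D a
TAME PROBE through D if it is tame on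
ONE fixed asymptotically flat end e of X (`IsTameDataFamily e k Φ`: every member
Dafermos–Rodnianski-flat on e with continuous mass,
weighted-C²×C¹-continuous at 0) and immersed at 0 (`IsImmersedAtZero k Φ`), k ≥ 2 (physically: D
plus k small same-end gravitational-wave
kicks glued at finite radius); its punctured exceptional trace is T_Φ = {λ ≠ 0, ‖λ‖ < δ : Φ(λ)
exceptional}, where "exceptional" now means:
some MGHD fails "complete 𝓘⁺ and a sub-extremal finitely-many-Kerr `FinalStateDecomposition` of O =
exteriorOf with `RaysStayInClosure`,
`HasExhaustiveCharts` (honest radii) and `IsFutureOriented`". C (CensorshipTraceNull): every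
admissible datum one of whose MGHDs has
INCOMPLETE future null infinity is the centre of a tame probe whose punctured trace is covered by a
(k−1)-Hausdorff-null set plus finitely
many zero sets of functions differentiable at 0 with non-zero differential ("walls"). S
(SettlingTraceNull): the same for admissible data
all of whose MGHDs have complete 𝓘⁺ but one of which fails the re-typed settling clause. M
(AdmissibleMGHDExists): every admissible datum has
an MGHD over the repaired `VacuumCauchyDevelopment` structure. Two routine lemmas turn X into the
typed statement: LinePiercing (GMT in ℝᵏ,
PROVED: null dust + finitely many walls ⇒ a.e. direction θ gives a punctured segment tθ off the
trace) and TameSegmentToCurve (a punctured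
good segment of a TAME IMMERSED probe reparametrises, by arctan, to the tame immersed injective
one-parameter admissible family on the same
end e that `IsTameChristodoulouGeneric … 1` asks for; tame upgrade of the proved SegmentToCurve).
Lean: `(∀ (X : Type) [TopologicalSpace X] [ChartedSpace Literature.Geometry.Lorentzian.E3 X]
[IsManifold (𝓡 3) ((⊤ : ℕ∞) : WithTop ℕ∞) X] [T2Space X] [SecondCountableTopology X] [ConnectedSpace
X], ∀ D ∈ Literature.Geometry.Lorentzian.admissibleVacuumData X, (∃ 𝒟 :
Literature.Geometry.Lorentzian.VacuumCauchyDevelopment D, 𝒟.IsMaximal ∧ ¬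
Summit.FinalStateConjecture.HasCompleteNullInfinity 𝒟.toCauchyDevelopment) → ∃ (e :
Literature.Geometry.Lorentzian.AFEnd X) (k : ℕ) (Φ : EuclideanSpace ℝ (Fin k) →
Literature.Geometry.Lorentzian.InitialDataSet (𝓡 3) X), 2 ≤ k ∧
Literature.Geometry.Lorentzian.InitialDataSet.IsTameDataFamily e k Φ ∧
Literature.Geometry.Lorentzian.InitialDataSet.IsImmersedAtZero k Φ ∧ Function.Injective Φ ∧ Φ 0 = D
∧ (∀ c, Φ c ∈ Literature.Geometry.Lorentzian.admissibleVacuumData X) ∧ ∃ (δ : ℝ) (N : Set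
(EuclideanSpace ℝ (Fin k))) (m : ℕ) (g : Fin m → EuclideanSpace ℝ (Fin k) → ℝ) (L : Fin m →
(EuclideanSpace ℝ (Fin k) →L[ℝ] ℝ)), 0 < δ ∧ μH[(k : ℝ) - 1] N = 0 ∧ (∀ i, HasFDerivAt (g i) (L i) 0
∧ L i ≠ 0) ∧ ∀ c, ‖c‖ < δ → c ≠ 0 → ¬ (∀ 𝒟 : Literature.Geometry.Lorentzian.VacuumCauchyDevelopment
(Φ c), 𝒟.IsMaximal → Summit.FinalStateConjecture.HasCompleteNullInfinity 𝒟.toCauchyDevelopment ∧ ∃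
(O : Set 𝒟.carrier) (d : Literature.Geometry.Lorentzian.FinalStateDecomposition 𝒟.toSpacetime O 2),
(∀ i, Literature.Geometry.Lorentzian.Kerr.IsSubextremal (d.mass i) (d.spin i)) ∧ O =
Summit.FinalStateConjecture.exteriorOf 𝒟.toCauchyDevelopment d.charted ∧
Summit.FinalStateConjecture.RaysStayInClosure 𝒟.toCauchyDevelopment O ∧
Summit.FinalStateConjecture.HasExhaustiveCharts d ∧ Summit.FinalStateConjecture.IsFutureOriented d)
→ c ∈ N ∨ ∃ i, g i c = 0) ∧ (∀ (X : Type) [TopologicalSpace X] [ChartedSpace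
Literature.Geometry.Lorentzian.E3 X] [IsManifold (𝓡 3) ((⊤ : ℕ∞) : WithTop ℕ∞) X] [T2Space X]
[SecondCountableTopology X] [ConnectedSpace X], ∀ D ∈
Literature.Geometry.Lorentzian.admissibleVacuumData X, (∀ 𝒟 :
Literature.Geometry.Lorentzian.VacuumCauchyDevelopment D, 𝒟.IsMaximal →
Summit.FinalStateConjecture.HasCompleteNullInfinity 𝒟.toCauchyDevelopment) → (∃ 𝒟 :
Literature.Geometry.Lorentzian.VacuumCauchyDevelopment D, 𝒟.IsMaximal ∧ ¬ ∃ (O : Set 𝒟.carrier) (d :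
Literature.Geometry.Lorentzian.FinalStateDecomposition 𝒟.toSpacetime O 2), (∀ i,
Literature.Geometry.Lorentzian.Kerr.IsSubextremal (d.mass i) (d.spin i)) ∧ O =
Summit.FinalStateConjecture.exteriorOf 𝒟.toCauchyDevelopment d.charted ∧
Summit.FinalStateConjecture.RaysStayInClosure 𝒟.toCauchyDevelopment O ∧
Summit.FinalStateConjecture.HasExhaustiveCharts d ∧ Summit.FinalStateConjecture.IsFutureOriented d)
→ ∃ (e : Literature.Geometry.Lorentzian.AFEnd X) (k : ℕ) (Φ : EuclideanSpace ℝ (Fin k) →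
Literature.Geometry.Lorentzian.InitialDataSet (𝓡 3) X), 2 ≤ k ∧
Literature.Geometry.Lorentzian.InitialDataSet.IsTameDataFamily e k Φ ∧
Literature.Geometry.Lorentzian.InitialDataSet.IsImmersedAtZero k Φ ∧ Function.Injective Φ ∧ Φ 0 = D
∧ (∀ c, Φ c ∈ Literature.Geometry.Lorentzian.admissibleVacuumData X) ∧ ∃ (δ : ℝ) (N : Set
(EuclideanSpace ℝ (Fin k))) (m : ℕ) (g : Fin m → EuclideanSpace ℝ (Fin k) → ℝ) (L : Fin m →
(EuclideanSpace ℝ (Fin k) →L[ℝ] ℝ)), 0 < δ ∧ μH[(k : ℝ) - 1] N = 0 ∧ (∀ i, HasFDerivAt (g i) (L i) 0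
∧ L i ≠ 0) ∧ ∀ c, ‖c‖ < δ → c ≠ 0 → ¬ (∀ 𝒟 : Literature.Geometry.Lorentzian.VacuumCauchyDevelopment
(Φ c), 𝒟.IsMaximal → Summit.FinalStateConjecture.HasCompleteNullInfinity 𝒟.toCauchyDevelopment ∧ ∃
(O : Set 𝒟.carrier) (d : Literature.Geometry.Lorentzian.FinalStateDecomposition 𝒟.toSpacetime O 2),
(∀ i, Literature.Geometry.Lorentzian.Kerr.IsSubextremal (d.mass i) (d.spin i)) ∧ O =
Summit.FinalStateConjecture.exteriorOf 𝒟.toCauchyDevelopment d.charted ∧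
Summit.FinalStateConjecture.RaysStayInClosure 𝒟.toCauchyDevelopment O ∧
Summit.FinalStateConjecture.HasExhaustiveCharts d ∧ Summit.FinalStateConjecture.IsFutureOriented d)
→ c ∈ N ∨ ∃ i, g i c = 0) ∧ (∀ (X : Type) [TopologicalSpace X] [ChartedSpace
Literature.Geometry.Lorentzian.E3 X] [IsManifold (𝓡 3) ((⊤ : ℕ∞) : WithTop ℕ∞) X] [T2Space X]
[SecondCountableTopology X] [ConnectedSpace X], ∀ D ∈
Literature.Geometry.Lorentzian.admissibleVacuumData X, ∃ 𝒟 :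
Literature.Geometry.Lorentzian.VacuumCauchyDevelopment D, 𝒟.IsMaximal)`

## Assembly
Pure logic, PROVED sorry-free in the planner's Sketch.lean / glue.lean (theorem `closes`, axioms
propext / Classical.choice / Quot.sound,
lean check rc 0 on the farm, 2026-08-16): fix X and an exceptional admissible D; M gives an MGHD, so
D fails the universal clause; either
some MGHD has incomplete 𝓘⁺ (apply C) or all have complete 𝓘⁺ and one fails the re-typed settling
clause (apply S); the tame probe's
punctured exceptional trace feeds LinePiercing (T := {λ : Φ(λ) fails the universal clause}), the
resulting punctured segment consists of
admissible data satisfying the universal clause and (by M) having an MGHD, i.e. of NON-exceptional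
data, and TameSegmentToCurve returns
the tame (same end e), immersed, injective admissible curve through D = Φ(0) demanded by
`IsTameChristodoulouGeneric (admissibleVacuumData X) P 1`.
The deciding theorem `closes : CensorshipTraceNull → SettlingTraceNull → AdmissibleMGHDExists →
LinePiercing → TameSegmentToCurve →
FinalStateConjecture` IS the assembly; no separate Assembly item is kept (the rev-3 item
stmt-FinalStateConjecture-9966 and its frame proof
in Theorems/ProbeNullTraceAssemblyFrame.lean, which inlined the OLD summit body, are retired by the
re-type).

Rationale: WHY THIS LINE. Hunt–Sauer–Yorke prevalence (HuntSauerYorke1992) makes "almost every" meaningful in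
infinite dimensions by testing a set against translates
of a FINITE-DIMENSIONAL probe; Christodoulou's own instability theorem
(Christodoulou1999instability, Thm 4.1: the affine 2-plane
ϑ + span{f₁, f₂} meets E only at ϑ) is a probe statement with empty punctured trace inside a FIXED
space of data with fixed asymptotics —
exactly the tameness the re-typed summit now demands (Christodoulou1999 p. A24) — and every
numerical genericity claim since Choptuik is a
statement about traces of the black-hole threshold on 1- or 2-parameter families
(GundlachMartingarcia2007). The line imports geometric
measure theory (Hausdorff measure under Lipschitz maps, EvansGariepy2015 Thm 2.8; Mattila1995) to
replace "find a curve through every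
exceptional datum" by "bound the (k−1)-dimensional Hausdorff measure of the punctured trace along
ONE tame probe", which is what
perturbation theory plus Sard/dimension estimates can deliver and which is σ-additive: countable
unions of lower strata cost nothing, no
stratification, definability (card tame-strata-curve-selection) or general position (card
genericity-is-not-closed-under-and) is needed,
and only the genuine codimension-one strata (black-hole threshold, extremal threshold) must be shown
to be walls. The split of X by the
stratum of the datum (C: weak-cosmic-censorship-type data, RodnianskiShlapentokhRothman2023, An2025;
S: third-law / rigidity / final-state
data, KehleUnger2025, DafermosLuk2017) matches the two literatures that will attack them; M isolates
the typing risk every route on this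
summit shares (ChoquetBruhatGeroch1969CMP, Sbierski2016AHP). REPAIR 2026-08-16 (re-type T2,
p126844): probes are TAME on one fixed end and
IMMERSED at 0 (so the pierced curve is a legal `HasTameCodimAtLeastIn` witness — the burial-type
families the re-type excludes were never
probes of this line), good parameters must satisfy the re-typed settled clause (`RaysStayInClosure`,
honest radii, `IsFutureOriented`),
and the deciding theorem is crux-only: its routine hypotheses AdmissibleMGHDExists, LinePiercing
(proved) and TameSegmentToCurve are
crux-kinded at ranks 4/9/9 because their proof modules cannot be imported into the route file
without a cycle.

RANKED CRUXES. #2 CensorshipTraceNull (crux) — for every admissible datum D (any X) having a maximal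
vacuum Cauchy development with INCOMPLETE future null infinity there are one asymptotically flat end
e of X, k ≥ 2 and a TAME (on e), IMMERSED-at-0, injective admissible k-probe Φ through D, δ > 0, a
μH[k−1]-null set N ⊆ ℝᵏ and finitely many g_i : ℝᵏ → ℝ differentiable at 0 with non-zero
differential, such that every λ with 0 < ‖λ‖ < δ at which Φ(λ) fails "all MGHDs have complete 𝓘⁺ and
settle to finitely many sub-extremal Kerrs (O = exteriorOf, RaysStayInClosure, HasExhaustiveCharts
with honest radii, IsFutureOriented)" lies in N or in some {g_i = 0} (card K2, NS stratum; restated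
2026-08-16 for the re-typed summit: tame probe, re-typed settled clause). [difficulty: open-problem]
(why it might fail: Off the trace a SMOOTH same-end kick must censor AND settle with honest
future-oriented charts: naked-singularity instability is a rough-kick (BV) effect, C^{1,α} kicks
leave them stable (arXiv:2605.16235); Kerr capture open beyond |a|≪M; fractal thresholds
(SzybkaChmaj2008) may be H^{k-1}-fat.) [Christodoulou1999instability, arXiv:2605.16235, LiuLi2018,
An2025, RodnianskiShlapentokhRothman2023, doi:10.5802/crmeca.284, KlainermanSzeftel2023,
SzybkaChmaj2008, GundlachMartingarcia2007,
Literature.Barriers.FinalStateConjecture.nakedSingularityInstability]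
#3 SettlingTraceNull (crux) — for every admissible datum D all of whose maximal vacuum Cauchy
developments have complete future null infinity but one of which admits NO sub-extremal
finitely-many-Kerr final-state decomposition d of O = exteriorOf with RaysStayInClosure,
HasExhaustiveCharts (honest radii) and IsFutureOriented, the same conclusion: one end e, a tame (on
e) immersed injective admissible k-probe (k ≥ 2) through D whose punctured exceptional trace near 0
lies in a μH[k−1]-null set plus finitely many zero sets of functions differentiable at 0 with
non-zero differential (card K2, EXT/BR strata: the extremal threshold is a wall by third-law
transversality, non-Kerr or non-decaying exteriors are dust; restated 2026-08-16 for the re-typed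
summit). [difficulty: open-problem] (why it might fail: Along a tame probe through LARGE data: a.e.
kick captured into honestly charted sub-extremal Kerr, rays in closure O (known only |a|≪M,
KlainermanSzeftel2023); extremal-forming data on finitely many C¹-at-0 walls (codim 1 only
conjectured, arXiv:2402.10190); no open set of non-Kerr ends.) [KehleUnger2025, arXiv:2402.10190,
AngelopoulosKehleUnger2024, Aretakis2015, KlainermanSzeftel2023, arXiv:2205.14808,
DafermosHolzegelRodnianskiTaylor2021, arXiv:1710.01722,
Literature.Barriers.FinalStateConjecture.AretakisInstability,
Literature.Barriers.FinalStateConjecture.SlowlyRotatingKerrFrontier]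
#4 AdmissibleMGHDExists (crux) — every admissible vacuum datum (smooth, constraints, complete, one
strongly asymptotically flat end) on any connected Hausdorff second-countable 3-manifold has a
maximal globally hyperbolic vacuum development in the sense of the repaired structure
`VacuumCauchyDevelopment … IsMaximal` (Choquet-Bruhat–Geroch 1969 Thm 3, Sbierski 2016 Thm 2.6; the
anti-vacuity conjunct of the summit, shared by signature with TangentProfileCensorship.MGHDExistence
and the other routes of the summit; crux-kinded since 2026-08-16 because it is a hypothesis of the
crux-only deciding theorem, exactly as HomotheticSurfaceGravity / MergerLatticeBudget badge the same
shared item). [difficulty: XL] (why it might fail: Known in print (CBG 1969 Thm 3 = fact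
choquetBruhat_geroch_exists_mghd_cauchy) but typed over the REPAIRED prelude: IsMaximal asks EVERY
typed VacuumCauchyDevelopment (one universe, ι-compatible embeddings) to embed; a rogue typed
development kills it (cf. choquetBruhat_geroch_exists_mghd).)
[Literature.Geometry.Lorentzian.choquetBruhat_geroch_exists_mghd_cauchy, ChoquetBruhatGeroch1969CMP,
Sbierski2016AHP, Ringstrom2009]
#9 LinePiercing (crux) — (finite-dimensional GMT; PROVED 2026-08-16 in
Theorems/ProbeNullTraceLinePiercing.lean @ 436fd698de69, item stmt-FinalStateConjecture-9964 closed)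
in ℝᵏ, k ≥ 2: if the points of T in the punctured δ-ball lie in N ∪ ⋃_i {g_i = 0} with μH[k−1](N) =
0 and each g_i differentiable at 0 with non-zero differential, then some θ ≠ 0 and ε > 0 have tθ ∉ T
for all 0 < |t| < ε. Crux-kinded (rank 9) only because it is a hypothesis of the crux-only deciding
theorem and its proof module imports the route file, so the gate cannot discharge it by a `_holds`
link; a frame-form re-landing (module importing Mathlib only, statement verbatim) would let a tenure
edit use it inside `closes` and re-kind it support. [difficulty: provable-now] (why it might fail:
It cannot: PROVED sorry-free in Theorems/ProbeNullTraceLinePiercing.lean (item 9964 closed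
2026-08-16); the only residue is bookkeeping — that proof module imports the route file, so the
hypothesis is not dischargeable by a `_holds` link.) [EvansGariepy2015, Mattila1995]
#9 TameSegmentToCurve (crux) — (tame reparametrisation, provable now; NEW 2026-08-16, the tame
upgrade of the proved SegmentToCurve) if Φ is a k-parameter family of data in 𝓓 that is tame on the
end e, immersed at 0 and injective, and the punctured segment {Φ(tθ) : 0 < |t| < ε} (θ ≠ 0) avoids
𝓔, then F(c) := Φ(σ(c₀)·θ), σ(s) = (ε/2)·arctan s, is a one-parameter family in 𝓓, TAME ON THE SAME
END e (smoothness by precomposition, as in Theorems/ProbeNullTraceSegmentToCurve.lean; same sole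
end; mass M∘σ continuous; e.wDist(F c, F 0) → 0 by composing the probe's continuity at 0 with σ →
0), IMMERSED AT 0 (chain rule: ∂_v(F-component)(0) = (ε/2)·v₀·∂_θ(Φ-component)(0) ≠ 0, using the
probe's immersion in the direction θ), injective, with F 0 = Φ 0, meeting 𝓔 at most at c = 0 —
exactly the witness `HasTameCodimAtLeastIn 𝓓 𝓔 1` asks for at Φ(0). Crux-kinded (rank 9) only for
the crux-only deciding theorem; routine. [difficulty: provable-now] (why it might fail: Routine
(S–M). Sole subtlety: `IsImmersedAtZero` is phrased with `fderiv` (junk 0), so transferring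
immersion along σ needs differentiability at 0 of the scalar component c ↦ (Φ c).h.inner x u w —
forced, since its fderiv at 0 is non-zero in the direction θ.) [Christodoulou1999,
Christodoulou1999instability, Literature.Geometry.Lorentzian.InitialDataSet.IsTameDataFamily,
Literature.Geometry.Lorentzian.InitialDataSet.IsImmersedAtZero]
#9 SegmentToCurve (support) — (reparametrisation; PROVED 2026-08-16 in
Theorems/ProbeNullTraceSegmentToCurve.lean @ 045c7b513df3, item stmt-FinalStateConjecture-9965
closed; no longer a hypothesis of `closes`, superseded as glue by TameSegmentToCurve, whose prover
can reuse that file's precomposition and arctan-squash lemmas) if Φ is a smooth injective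
k-parameter family of data in 𝓓 and the punctured segment {Φ(tθ) : 0 < |t| < ε} (θ ≠ 0) avoids 𝓔,
then F(c) := Φ((ε/2)·arctan(c₀)·θ) is a smooth injective one-parameter family in 𝓓 with F(0) = Φ(0)
meeting 𝓔 at most at c = 0. [difficulty: provable-now] [Christodoulou1999,
Christodoulou1999instability]

TWO-LAYER PLAN. Foreseen glued splits (nothing filed now). C ⇐ C1 → C2 → C with C1 = WALLS: near a
datum whose naked singularity is governed by a
HYPERBOLIC critical/self-similar profile, first-singularity data along any tame probe lie in
finitely many zero sets of functions
differentiable at 0 (stable-manifold hypersurfaces transversal to an amplitude direction: the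
blue-shift/trapped-surface instability of
Christodoulou–Liu–Li–An made quantitative along kicks), C2 = DUST: the remaining threshold points
(non-hyperbolic exchange loci, chaotic
sets) have (k−1)-null trace (uncertainty-exponent / Lyapunov-dimension bound). S ⇐ S1 → S2 → S with
S1 = the extremal threshold is a wall
(extremality gap of the forming hole differentiable at 0 with non-zero derivative along some kick:
third-law transversality, card
third-law-transversality-injection), S2 = non-Kerr / non-decaying / N = ∞ exteriors and charting
failures (rays leaving closure O, chart
time against causal order) have (k−1)-null trace (rigidity + capture into the Kerr basin is open
along probes). PREVALENCE LAYER (after the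
definition request lands): UniversalPulseShy — the exceptional set is HSY-shy with respect to a
universal (datum-independent, jointly
continuous) family of late same-end pulses, and shy + G_δ ⇒ Baire-generic (card K1/K3); it
strengthens C ∧ S from "some probe per datum" to
"one probe for all data".

KILL CRITERIA. Refuted:CensorshipTraceNull closes the route outright if the witness is STRUCTURAL —
an admissible datum at which every tame probe has a
punctured exceptional trace of positive (k−1)-measure outside finitely many walls (a
laminated/Cantor black-hole threshold, uncertainty
exponent α < 1): by the lamination lemma (card threshold-lamination-vs-curve-genericity) the typed
summit is then false too, and the witness
goes to a ¬FinalStateConjecture route. Refuted:SettlingTraceNull by a DEGENERATE third law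
(extremality preserved to second order along a
positive-measure cone of kicks) forces a pivot from lines to curved arcs (tame curve selection) —
restate S with definable walls; refuted by
an honest-charting obstruction (a settling development some of whose future-complete null rays from
Σ leave closure O) it is a Statement
matter for the operator's referee seat, not a kill of the line. Refuted:AdmissibleMGHDExists is a
typing defect: block on the operator's
re-audit of `CauchyDevelopment`, do not close. Refuted:TameSegmentToCurve / LinePiercing cannot
happen except by a typing slip (both are
routine; LinePiercing is proved) — repair by restating, never close. Mooted (superseded) if the
operator re-types "generic" again (then the
prevalence layer becomes the thesis).

NOT DECOMPOSED YET. The tame probe construction itself (far-field / finite-radius gluing of k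
incoming pulses on the SAME end preserving admissibility, DR
rates and weighted continuity: Corvino–Schoen / Carlotto–Schoen / characteristic gluing; immersion =
linear independence of the k pulse
jets), Cauchy stability and differentiability of outcome functionals in λ, the stratification of the
exceptional set into walls and dust,
the N = ∞ and non-decaying-exterior strata, the chart bookkeeping turning "settles physically" into
`FinalStateDecomposition …` with
`RaysStayInClosure ∧ HasExhaustiveCharts ∧ IsFutureOriented`, and the universal probe with HSY
transversality — all layer 2 (or the
prevalence layer); TameSegmentToCurve is the only item meant to close now (LinePiercing,
SegmentToCurve already closed).

CHEAPEST FALSIFIER. Consistency rung (free): in Christodoulou's BV scalar-field model the 2-plane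
Π_ϑ has EMPTY punctured trace (Thm 4.1) inside a fixed
space with fixed asymptotics, i.e. the crux shape holds with N = ∅, m = 0 and a tame probe.
Informative rung (literature/numerics): along
2-parameter families of vacuum Brill/Teukolsky waves near the collapse threshold, is the threshold a
C¹ curve (wall) or does the
collapse/dispersion outcome have uncertainty exponent α < 1 (fractal)? PRL 131 (2023) 181401 =
arXiv:2305.17171 reports competing
critical solutions but no basin-boundary dimension; a measured α < 1 on a positive-(k−1)-measure set
of threshold points kills
CensorshipTraceNull (and the typed summit). Typing rung (lean check, run 2026-08-16): the re-glued
`closes` elaborates sorry-free against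
the re-typed Statement (Sketch.lean rc 0).

NUMBERS. Christodoulou BV model: E has linear codimension 2, trace on Π_ϑ = {ϑ}
(Christodoulou1999instability Thm 4.1). DHRT (arXiv:2104.08222):
the Schwarzschild-forming family is a codimension-3 C¹ graph — wall-type. Scalar-field Choptuik
solution: one unstable mode, γ ≈ 0.374,
echoing period Δ ≈ 3.44 (GundlachMartingarcia2007 §3) ⇒ threshold locally a C¹ hypersurface in
finite-dimensional families (numerical).
Vacuum Brill-wave collapse: γ ≈ 0.37 historically, now disputed; ≥ 2 competing critical solutions
(arXiv:2305.17171). LinePiercing needs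
k ≥ 2 (for k = 1, H⁰-null = empty). Items after the 2026-08-16 repair: 6 (5 crux-kinded hypotheses
of `closes` — ranks 2, 3, 4 and two
rank-9 routine ones, one of them proved — plus 1 proved support); no Assembly item.

DEFINITION REQUESTS. `IsShy` / `IsPrevalent` (Hunt–Sauer–Yorke 1992, Defs 1–2, Facts 1–3): a Borel
set S in a completely metrizable abelian topological group
(in particular a Banach space) is SHY iff some compactly supported Borel probability measure μ has
μ(S + x) = 0 for every x; PREVALENT =
complement of shy; companion lemmas: shy sets form a translation-invariant σ-ideal, a shy set has
empty interior, finite-dimensional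
consistency (shy = Lebesgue-null in ℝⁿ), and the PROBE CRITERION (a Borel set Lebesgue-null on every
translate of some finite-dimensional
subspace is shy). Topic Literature/Analysis/Prevalence; Mathlib has nothing (`lean search
"HaarNull|[Pp]revalen|IsShy"`: no declaration).
Wanted for the prevalence layer only.

Novelty: Searches (2026-08-15, inherited from the opening planner; 2026-08-16 repair adds none — the
mechanism is unchanged): `lit search --source
zbmath "prevalence shy"` (9: HSY addendum math/9304213, Ott–Yorke 2005, Mycielski, Stinchcombe, … —
none in GR); `… "prevalence cosmic
censorship"` (0); `… "cosmic censorship generic codimension"` (4: Gundlach LRR gr-qc/9606023, Luk–Oh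
1501.04598, Costa e Silva et al.
2406.09651 — topological genericity of singularity theorems, not measure; Kofinas–Tomaras); `…
"genericity black hole formation threshold
measure zero initial data"` (0); `lit galaxy search --star all "prevalence shy set cosmic
censorship"` (0) and `"prevalent set of initial
data"` (0); galaxy bm25 --star pdf "HSY prevalence / shy / Haar-null for genericity of initial data
in GR, censorship, naked-singularity
instability" (12 generic hits: Winicour LRR 2009-3, Bartnik–Isenberg gr-qc/0405092, Kehle–Unger
2211.15742, Cook–Teukolsky — no
prevalence×censorship paper); `lean search "HaarNull|[Pp]revalen|IsShy"` (no decl).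
Nearest prior art found: Christodoulou1999instability Thm 4.1 (datum-dependent affine 2-plane with
EMPTY punctured trace in the BV
scalar-field model, inside a fixed space 𝓐 with fixed asymptotics — the N = ∅, m = 0, tame instance
of CensorshipTraceNull);
HuntSauerYorke1992 (doi:10.1090/s0273-0979-1992-00328-2: finite-dimensional probes define
prevalence); DafermosHolzegelRodnianskiTaylor2021
(arXiv:2104.08222: a codimension-3 C¹ threshold family, wall-type).
Delt  [refs: 10.1090/s0273-0979-1992-00328-2:, 2104.08222, doi:10.1090/s0273-0979-1992-00328-2, HuntSauerYorke1992, DafermosHolzegelRodnianskiTaylor2021]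

Barriers (technique_class: prevalence, finite-dimensional-probe, sard): - technique_class: prevalence, finite-dimensional-probe, sard
- Literature.Barriers.FinalStateConjecture.nakedSingularityInstability: respected and generalised —
genericity is KEPT (the cruxes are per-datum statements along tame probes, never all-data
censorship), and the barrier's positive half (Thm 4.1, a 2-plane meeting E only at ϑ inside a fixed
space with fixed asymptotics) is literally the N = ∅, tame case of CensorshipTraceNull; its scope
caveat (blue-shift instability is low-regularity; smooth naked-singularity data are not even
constructed) is why that crux is rank 2.
- Literature.Barriers.FinalStateConjecture.AretakisInstability: the extremal stratum enters
SettlingTraceNull only as a WALL (zero set of the extremality gap, differentiable at 0 along one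
transversal kick); no uniform-in-spin horizon decay is used — per-hole sub-extremal estimates are
all the summit consumes.
- Literature.Barriers.FinalStateConjecture.KehrbergerLogarithmicAsymptotics: not engaged — probes
are fast-decaying same-end modifications glued at finite radius and the outcome functionals are
final parameters and sojourn completeness, never conformal smoothness of 𝓘⁺.
- Literature.Barriers.FinalStateConjecture.SlowlyRotatingKerrFrontier: it does not evade it; the bet
is that differentiability of outcomes in λ near settling data (Cauchy stability + capture into the
Kerr basin over the full sub-extremal range, with honest future-oriented charts) becomes available —
until then SettlingTraceNull is

History (route lifecycle, newest last):
- 2026-08-16T23:19:46Z · rev 4: restated CensorshipTraceNull (stmt-FinalStateConjecture-9962), SettlingTraceNull (stmt-FinalStateConjecture-9963), Assembly (stmt-FinalStateConjecture-9966 proved) — route-repair (statement-revised p126844, re-type T2): CensorshipTraceNull/SettlingTraceNull restated 1:1 (tame immersed probe on one fixed end; set (planner-rrepair-FinalStateConjecture-ProbeNull-5467ea25-0)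
- 2026-08-24T06:16:01Z · DORMANT — reconciler: no traction for 6.6 d (last activity item-evidence-added at 2026-08-17T15:45:33Z); parked, not closed — `ledger route dormant route-FinalStateConjec (operator:999:3632038)
- 2026-08-30T17:07:33Z · REACTIVATED (open) — reconciler: reactivated — activity statement-checked at 2026-08-30T15:54:01Z after parking at 2026-08-24T06:16:01Z (operator:999:456767)
- 2026-09-04T18:34:00Z · DORMANT — reconciler: no traction for 5 d (last activity statement-checked at 2026-08-30T17:44:34Z); parked, not closed — `ledger route dormant route-FinalStateConjecture (operator:999:2130622)

sub-problem: FinalStateConjecture · status: dormant · opened planner-plancard-FinalStateConjecture-FinalSt-ffbdb45c-0 2026-08-15T14:57:52Z · rev 5 · ledger route-FinalStateConjecture-ProbeNullTrace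
GENERATED by the gate from the ledger (D-0016/17). Provers cite these decls: `theorem foo : Summit.FinalStateConjecture.FinalStateConjecture.Theses.ProbeNullTrace.<Decl> := …` in Summits/FinalStateConjecture/FinalStateConjecture/Theorems/<Name>.lean.
-/

namespace Summit.FinalStateConjecture.FinalStateConjecture.Theses.ProbeNullTrace

open scoped BigOperators Topology Manifold Classical MeasureTheory ProbabilityTheory Matrix InnerProductSpace ComplexConjugate ContinuousMap
open Filter Set Function TopologicalSpace MeasureTheory

attribute [summit_statement] _root_.FinalStateConjecture

-- earlier CensorshipTraceNull (stmt-FinalStateConjecture-9962, replaced 2026-08-16T23:19:46Z -> stmt-FinalStateConjecture-17470): retired by None — ∀ (X : Type) [TopologicalSpace X] [ChartedSpace Literature.Geometry.Lorentzian.E3 X] [IsManifold (𝓡 3) ((⊤ : ℕ∞) : WithTop ℕ∞) X] [T2Space X] [SecondCountableTopology X] [ConnectedSpace X], ∀ D ∈ Literature.Geometry.Lorentzian.admissibleVacuumData X, (∃ 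
/-- item stmt-FinalStateConjecture-17470 · crux · rank 2 · open · by planner
why it might fail: Off the trace a SMOOTH same-end kick must censor AND settle with honest future-oriented charts: naked-singularity instability is a rough-kick (BV) effect, C^{1,α} kicks leave them stable (arXiv:2605.16235); Kerr capture open beyond |a|≪M; fractal thresholds (SzybkaChmaj2008) may be H^{k-1}-fat.
sources: Christodoulou1999instability, arXiv:2605.16235, LiuLi2018, An2025, RodnianskiShlapentokhRothman2023, doi:10.5802/crmeca.284
[crux] for every admissible datum D (any X) having a maximal vacuum Cauchy development with
INCOMPLETE future null infinity there are one asymptotically flat end e of X, k ≥ 2 and a TAME (on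
e), IMMERSED-at-0, injective admissible k-probe Φ through D, δ > 0, a μH[k−1]-null set N ⊆ ℝᵏ and
finitely many g_i : ℝᵏ → ℝ differentiable at 0 with non-zero differential, such that every λ with 0
< ‖λ‖ < δ at which Φ(λ) fails "all MGHDs have complete 𝓘⁺ and settle to finitely many sub-extremal
Kerrs (O = exteriorOf, RaysStayInClosure, HasExhaustiveCharts with honest radii, IsFutureOriented)"
lies in N or in some {g_i = 0} (card K2, NS stratum; restated 2026-08-16 for the re-typed summit:
tame probe, re-typed settled clause). [difficulty: open-problem] -/
@[route_item "route-FinalStateConjecture-ProbeNullTrace"]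
def CensorshipTraceNull : Prop :=
  ∀ (X : Type) [TopologicalSpace X] [ChartedSpace Literature.Geometry.Lorentzian.E3 X] [IsManifold (𝓡 3) ((⊤ : ℕ∞) : WithTop ℕ∞) X] [T2Space X] [SecondCountableTopology X] [ConnectedSpace X], ∀ D ∈ Literature.Geometry.Lorentzian.admissibleVacuumData X, (∃ 𝒟 : Literature.Geometry.Lorentzian.VacuumCauchyDevelopment D, 𝒟.IsMaximal ∧ ¬ Summit.FinalStateConjecture.HasCompleteNullInfinity 𝒟.toCauchyDevelopment) → ∃ (e : Literature.Geometry.Lorentzian.AFEnd X) (k : ℕ) (Φ : EuclideanSpace ℝ (Fin k) → Literature.Geometry.Lorentzian.InitialDataSet (𝓡 3) X), 2 ≤ k ∧ Literature.Geometry.Lorentzian.InitialDataSet.IsTameDataFamily e k Φ ∧ Literature.Geometry.Lorentzian.InitialDataSet.IsImmersedAtZero k Φ ∧ Function.Injective Φ ∧ Φ 0 = D ∧ (∀ c, Φ c ∈ Literature.Geometry.Lorentzian.admissibleVacuumData X) ∧ ∃ (δ : ℝ) (N : Set (EuclideanSpace ℝ (Fin k))) (m : ℕ) (g : Fin m → EuclideanSpace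 ℝ (Fin k) → ℝ) (L : Fin m → (EuclideanSpace ℝ (Fin k) →L[ℝ] ℝ)), 0 < δ ∧ μH[(k : ℝ) - 1] N = 0 ∧ (∀ i, HasFDerivAt (g i) (L i) 0 ∧ L i ≠ 0) ∧ ∀ c, ‖c‖ < δ → c ≠ 0 → ¬ (∀ 𝒟 : Literature.Geometry.Lorentzian.VacuumCauchyDevelopment (Φ c), 𝒟.IsMaximal → Summit.FinalStateConjecture.HasCompleteNullInfinity 𝒟.toCauchyDevelopment ∧ ∃ (O : Set 𝒟.carrier) (d : Literature.Geometry.Lorentzian.FinalStateDecomposition 𝒟.toSpacetime O 2), (∀ i, Literature.Geometry.Lorentzian.Kerr.IsSubextremal (d.mass i) (d.spin i)) ∧ O = Summit.FinalStateConjecture.exteriorOf 𝒟.toCauchyDevelopment d.charted ∧ Summit.FinalStateConjecture.RaysStayInClosure 𝒟.toCauchyDevelopment O ∧ Summit.FinalStateConjecture.HasExhaustiveCharts d ∧ Summit.FinalStateConjecture.IsFutureOriented d) → c ∈ N ∨ ∃ i, g i c = 0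

-- earlier SettlingTraceNull (stmt-FinalStateConjecture-9963, replaced 2026-08-16T23:19:46Z -> stmt-FinalStateConjecture-17471): retired by None — ∀ (X : Type) [TopologicalSpace X] [ChartedSpace Literature.Geometry.Lorentzian.E3 X] [IsManifold (𝓡 3) ((⊤ : ℕ∞) : WithTop ℕ∞) X] [T2Space X] [SecondCountableTopology X] [ConnectedSpace X], ∀ D ∈ Literature.Geometry.Lorentzian.admissibleVacuumData X, (∀ 𝒟 
/-- item stmt-FinalStateConjecture-17471 · crux · rank 3 · open · by planner
why it might fail: Along a tame probe through LARGE data: a.e. kick captured into honestly charted sub-extremal Kerr, rays in closure O (known only |a|≪M, KlainermanSzeftel2023); extremal-forming data on finitely many C¹-at-0 walls (codim 1 only conjectured, arXiv:2402.10190); no open set of non-Kerr ends.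
sources: KehleUnger2025, arXiv:2402.10190, AngelopoulosKehleUnger2024, Aretakis2015, KlainermanSzeftel2023, arXiv:2205.14808
[crux] for every admissible datum D all of whose maximal vacuum Cauchy developments have complete
future null infinity but one of which admits NO sub-extremal finitely-many-Kerr final-state
decomposition d of O = exteriorOf with RaysStayInClosure, HasExhaustiveCharts (honest radii) and
IsFutureOriented, the same conclusion: one end e, a tame (on e) immersed injective admissible
k-probe (k ≥ 2) through D whose punctured exceptional trace near 0 lies in a μH[k−1]-null set plus
finitely many zero sets of functions differentiable at 0 with non-zero differential (card K2, EXT/BR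
strata: the extremal threshold is a wall by third-law transversality, non-Kerr or non-decaying
exteriors are dust; restated 2026-08-16 for the re-typed summit). [difficulty: open-problem] -/
@[route_item "route-FinalStateConjecture-ProbeNullTrace"]
def SettlingTraceNull : Prop :=
  ∀ (X : Type) [TopologicalSpace X] [ChartedSpace Literature.Geometry.Lorentzian.E3 X] [IsManifold (𝓡 3) ((⊤ : ℕ∞) : WithTop ℕ∞) X] [T2Space X] [SecondCountableTopology X] [ConnectedSpace X], ∀ D ∈ Literature.Geometry.Lorentzian.admissibleVacuumData X, (∀ 𝒟 : Literature.Geometry.Lorentzian.VacuumCauchyDevelopment D, 𝒟.IsMaximal → Summit.FinalStateConjecture.HasCompleteNullInfinity 𝒟.toCauchyDevelopment) → (∃ 𝒟 : Literature.Geometry.Lorentzian.VacuumCauchyDevelopment D, 𝒟.IsMaximal ∧ ¬ ∃ (O : Set 𝒟.carrier) (d : Literature.Geometry.Lorentzian.FinalStateDecomposition 𝒟.toSpacetime O 2), (∀ i, Literature.Geometry.Lorentzian.Kerr.IsSubextremal (d.mass i) (d.spin i)) ∧ O = Summit.FinalStateConjecture.exteriorOf 𝒟.toCauchyDevelopment d.charted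 ∧ Summit.FinalStateConjecture.RaysStayInClosure 𝒟.toCauchyDevelopment O ∧ Summit.FinalStateConjecture.HasExhaustiveCharts d ∧ Summit.FinalStateConjecture.IsFutureOriented d) → ∃ (e : Literature.Geometry.Lorentzian.AFEnd X) (k : ℕ) (Φ : EuclideanSpace ℝ (Fin k) → Literature.Geometry.Lorentzian.InitialDataSet (𝓡 3) X), 2 ≤ k ∧ Literature.Geometry.Lorentzian.InitialDataSet.IsTameDataFamily e k Φ ∧ Literature.Geometry.Lorentzian.InitialDataSet.IsImmersedAtZero k Φ ∧ Function.Injective Φ ∧ Φ 0 = D ∧ (∀ c, Φ c ∈ Literature.Geometry.Lorentzian.admissibleVacuumData X) ∧ ∃ (δ : ℝ) (N : Set (EuclideanSpace ℝ (Fin k))) (m : ℕ) (g : Fin m → EuclideanSpace ℝ (Fin k) → ℝ) (L : Fin m → (EuclideanSpace ℝ (Fin k) →L[ℝ] ℝ)), 0 < δ ∧ μH[(k : ℝ) - 1] N = 0 ∧ (∀ i, HasFDerivAt (g i) (L i) 0 ∧ L i ≠ 0) ∧ ∀ c, ‖c‖ < δ → c ≠ 0 → ¬ (∀ 𝒟 :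 Literature.Geometry.Lorentzian.VacuumCauchyDevelopment (Φ c), 𝒟.IsMaximal → Summit.FinalStateConjecture.HasCompleteNullInfinity 𝒟.toCauchyDevelopment ∧ ∃ (O : Set 𝒟.carrier) (d : Literature.Geometry.Lorentzian.FinalStateDecomposition 𝒟.toSpacetime O 2), (∀ i, Literature.Geometry.Lorentzian.Kerr.IsSubextremal (d.mass i) (d.spin i)) ∧ O = Summit.FinalStateConjecture.exteriorOf 𝒟.toCauchyDevelopment d.charted ∧ Summit.FinalStateConjecture.RaysStayInClosure 𝒟.toCauchyDevelopment O ∧ Summit.FinalStateConjecture.HasExhaustiveCharts d ∧ Summit.FinalStateConjecture.IsFutureOriented d) → c ∈ N ∨ ∃ i, g i c = 0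

/-- item stmt-FinalStateConjecture-9937 · crux · rank 4 · open · by planner
why it might fail: Known in print (CBG 1969 Thm 3 = fact choquetBruhat_geroch_exists_mghd_cauchy) but typed over the REPAIRED prelude: IsMaximal asks EVERY typed VacuumCauchyDevelopment (one universe, ι-compatible embeddings) to embed; a rogue typed development kills it (cf. choquetBruhat_geroch_exists_mghd).
sources: Literature.Geometry.Lorentzian.choquetBruhat_geroch_exists_mghd_cauchy, ChoquetBruhatGeroch1969CMP, Sbierski2016AHP, Ringstrom2009
[support] every admissible datum has a maximal globally hyperbolic vacuum development, stated over
the repaired structure `VacuumCauchyDevelopment` (the corrected form of the deprecated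
`choquetBruhat_geroch_exists_mghd`, recorded in `CauchyProblemExistenceDefect`);
Choquet-Bruhat–Geroch 1969 Thm. 3, Sbierski 2016 Thm. 2.6. Known theorem; large formalisation;
shared by every route of this summit. [difficulty: XL] -/
@[route_item "route-FinalStateConjecture-ProbeNullTrace"]
def AdmissibleMGHDExists : Prop :=
  ∀ (X : Type) [TopologicalSpace X] [ChartedSpace Literature.Geometry.Lorentzian.E3 X] [IsManifold (𝓡 3) ((⊤ : ℕ∞) : WithTop ℕ∞) X] [T2Space X] [SecondCountableTopology X] [ConnectedSpace X], ∀ D ∈ Literature.Geometry.Lorentzian.admissibleVacuumData X, ∃ 𝒟 : Literature.Geometry.Lorentzian.VacuumCauchyDevelopment D, 𝒟.IsMaximal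

/-- item stmt-FinalStateConjecture-17473 · crux · rank 9 · open · by planner
why it might fail: Routine (S–M). Sole subtlety: `IsImmersedAtZero` is phrased with `fderiv` (junk 0), so transferring immersion along σ needs differentiability at 0 of the scalar component c ↦ (Φ c).h.inner x u w — forced, since its fderiv at 0 is non-zero in the direction θ.
sources: Christodoulou1999, Christodoulou1999instability, Literature.Geometry.Lorentzian.InitialDataSet.IsTameDataFamily, Literature.Geometry.Lorentzian.InitialDataSet.IsImmersedAtZero
[crux] (tame reparametrisation, provable now; NEW 2026-08-16, the tame upgrade of the proved
SegmentToCurve) if Φ is a k-parameter family of data in 𝓓 that is tame on the end e, immersed at 0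
and injective, and the punctured segment {Φ(tθ) : 0 < |t| < ε} (θ ≠ 0) avoids 𝓔, then F(c) :=
Φ(σ(c₀)·θ), σ(s) = (ε/2)·arctan s, is a one-parameter family in 𝓓, TAME ON THE SAME END e
(smoothness by precomposition, as in Theorems/ProbeNullTraceSegmentToCurve.lean; same sole end; mass
M∘σ continuous; e.wDist(F c, F 0) → 0 by composing the probe's continuity at 0 with σ → 0), IMMERSED
AT 0 (chain rule: ∂_v(F-component)(0) = (ε/2)·v₀·∂_θ(Φ-component)(0) ≠ 0, using the probe's
immersion in the direction θ), injective, with F 0 = Φ 0, meeting 𝓔 at most at c = 0 — exactly the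
witness `HasTameCodimAtLeastIn 𝓓 𝓔 1` asks for at Φ(0). Crux-kinded (rank 9) only for the crux-only
deciding theorem; routine. [difficulty: provable-now] -/
@[route_item "route-FinalStateConjecture-ProbeNullTrace"]
def TameSegmentToCurve : Prop :=
  ∀ (X : Type) [TopologicalSpace X] [ChartedSpace Literature.Geometry.Lorentzian.E3 X] [IsManifold (𝓡 3) ((⊤ : ℕ∞) : WithTop ℕ∞) X] (𝓓 𝓔 : Set (Literature.Geometry.Lorentzian.InitialDataSet (𝓡 3) X)) (e : Literature.Geometry.Lorentzian.AFEnd X) (k : ℕ) (Φ : EuclideanSpace ℝ (Fin k) → Literature.Geometry.Lorentzian.InitialDataSet (𝓡 3) X) (θ : EuclideanSpace ℝ (Fin k)) (ε : ℝ), Literature.Geometry.Lorentzian.InitialDataSet.IsTameDataFamily e k Φ → Literature.Geometry.Lorentzian.InitialDataSet.IsImmersedAtZero k Φ → Function.Injective Φ → (∀ c, Φ c ∈ 𝓓) → θ ≠ 0 → 0 < ε → (∀ t : ℝ, t ≠ 0 → |t| < ε → Φ (t • θ) ∉ 𝓔) → ∃ F : EuclideanSpace ℝ (Fin 1) → Literature.Geometry.Lorentzian.InitialDataSet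 (𝓡 3) X, Literature.Geometry.Lorentzian.InitialDataSet.IsTameDataFamily e 1 F ∧ Literature.Geometry.Lorentzian.InitialDataSet.IsImmersedAtZero 1 F ∧ F 0 = Φ 0 ∧ Function.Injective F ∧ (∀ c, F c ∈ 𝓓) ∧ ∀ c, c ≠ 0 → F c ∉ 𝓔

/-- item stmt-FinalStateConjecture-9964 · support · rank 9 · closed · proved by Summit.FinalStateConjecture.FinalStateConjecture.Theorems.linePiercing_proof @ f0d79e3991fc (prover) · by planner
sources: EvansGariepy2015, Mattila1995
[support] (finite-dimensional GMT, provable now) in ℝᵏ, k ≥ 2: if the points of T in the punctured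
δ-ball lie in N ∪ ⋃_i {g_i = 0} with μH[k−1](N) = 0 and each g_i differentiable at 0 with non-zero
differential, then some θ ≠ 0 and ε > 0 have tθ ∉ T for all 0 < |t| < ε. Proof: the cone ℝ·N is
Lebesgue-null (Hausdorff measure under the locally Lipschitz map (s, x) ↦ s x, or radial
projection), each {θ : Dg_i(0)θ = 0} is a proper hyperplane, so a.e. θ works; along such θ, g_i(tθ)
= t·Dg_i(0)θ + o(t) ≠ 0 for small t ≠ 0. [difficulty: provable-now] -/
@[route_item "route-FinalStateConjecture-ProbeNullTrace"]
def LinePiercing : Prop :=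
  ∀ (k : ℕ), 2 ≤ k → ∀ (T N : Set (EuclideanSpace ℝ (Fin k))) (δ : ℝ) (m : ℕ) (g : Fin m → EuclideanSpace ℝ (Fin k) → ℝ) (L : Fin m → (EuclideanSpace ℝ (Fin k) →L[ℝ] ℝ)), 0 < δ → μH[(k : ℝ) - 1] N = 0 → (∀ i, HasFDerivAt (g i) (L i) 0 ∧ L i ≠ 0) → (∀ c ∈ T, ‖c‖ < δ → c ≠ 0 → c ∈ N ∨ ∃ i, g i c = 0) → ∃ θ : EuclideanSpace ℝ (Fin k), θ ≠ 0 ∧ ∃ ε : ℝ, 0 < ε ∧ ∀ t : ℝ, t ≠ 0 → |t| < ε → t • θ ∉ T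

-- `LinePiercing` holds: proved by `Summit.FinalStateConjecture.FinalStateConjecture.Theorems.linePiercing_proof` @ f0d79e3991fc (its module imports this route file, so no `_holds` link can be stated here).

/-- item stmt-FinalStateConjecture-9965 · support · rank 9 · closed · proved by Summit.FinalStateConjecture.FinalStateConjecture.Theorems.segmentToCurve_proof @ fabac7c21226 (prover) · by planner
sources: Christodoulou1999, Christodoulou1999instability
[support] (reparametrisation, provable now) if Φ is a smooth injective k-parameter family of data in
𝓓 and the punctured segment {Φ(tθ) : 0 < |t| < ε} (θ ≠ 0) avoids 𝓔, then F(c) :=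
Φ((2ε/π)·arctan(c₀)·θ) is a smooth injective one-parameter family in 𝓓 with F(0) = Φ(0) meeting 𝓔 at
most at c = 0 — exactly the witness `HasCodimAtLeastIn 𝓓 𝓔 1` asks for at Φ(0) (joint smoothness =
ContMDiff composition with (c, x) ↦ (σ(c₀)θ, x)). [difficulty: provable-now] -/
@[route_item "route-FinalStateConjecture-ProbeNullTrace"]
def SegmentToCurve : Prop :=
  ∀ (X : Type) [TopologicalSpace X] [ChartedSpace Literature.Geometry.Lorentzian.E3 X] [IsManifold (𝓡 3) ((⊤ : ℕ∞) : WithTop ℕ∞) X] (𝓓 𝓔 : Set (Literature.Geometry.Lorentzian.InitialDataSet (𝓡 3) X)) (k : ℕ) (Φ : EuclideanSpace ℝ (Fin k) → Literature.Geometry.Lorentzian.InitialDataSet (𝓡 3) X) (θ : EuclideanSpace ℝ (Fin k)) (ε : ℝ), Literature.Geometry.Lorentzian.InitialDataSet.IsSmoothDataFamily k Φ → Function.Injective Φ → (∀ c, Φ c ∈ 𝓓) → θ ≠ 0 → 0 < ε → (∀ t : ℝ, t ≠ 0 → |t| < ε → Φ (t • θ) ∉ 𝓔) → ∃ F : EuclideanSpace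 ℝ (Fin 1) → Literature.Geometry.Lorentzian.InitialDataSet (𝓡 3) X, Literature.Geometry.Lorentzian.InitialDataSet.IsSmoothDataFamily 1 F ∧ F 0 = Φ 0 ∧ Function.Injective F ∧ (∀ c, F c ∈ 𝓓) ∧ ∀ c, c ≠ 0 → F c ∉ 𝓔

-- `SegmentToCurve` holds: proved by `Summit.FinalStateConjecture.FinalStateConjecture.Theorems.segmentToCurve_proof` @ fabac7c21226 (its module imports this route file, so no `_holds` link can be stated here).

-- earlier Assembly (stmt-FinalStateConjecture-9966, replaced 2026-08-16T23:19:46Z -> stmt-FinalStateConjecture-17472): proved by Summit.FinalStateConjecture.FinalStateConjecture.Theorems.ProbeNullTrace.assembly_frame_proof — CensorshipTraceNull → SettlingTraceNull → AdmissibleMGHDExists → LinePiercing → SegmentToCurve → FinalStateConjecture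
/-- item stmt-FinalStateConjecture-17472 · assembly · rank 1 · open · by planner
sources: Christodoulou1999, DafermosLuk2017
[assembly] CensorshipTraceNull → SettlingTraceNull → AdmissibleMGHDExists → LinePiercing →
TameSegmentToCurve → FinalStateConjecture (the root-level summit statement `FinalStateConjecture`);
literally the type of the route's sorry-free deciding theorem `closes` (re-glued 2026-08-16 for the
re-typed Statement p126844), so it is proved by `fun h₁ h₂ h₃ h₄ h₅ ↦ closes h₁ h₂ h₃ h₄ h₅` in any
module importing the route file. -/
@[route_item "route-FinalStateConjecture-ProbeNullTrace"]
def Assembly : Prop :=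
  CensorshipTraceNull → SettlingTraceNull → AdmissibleMGHDExists → LinePiercing → TameSegmentToCurve → FinalStateConjecture

/-! D-0027 §2.1 — DECIDING THEOREM (planner-authored via `route open/edit --closes-file`; by planner-rrepair-FinalStateConjecture-ProbeNull-5467ea25-0 2026-08-16T23:19:46Z):
its hypotheses are this route's items and its conclusion the sub-problem Statement (glue_lint), and it elaborates with this file. -/

/-- DECIDING THEOREM (D-0027 §2.1), pure logic, re-glued 2026-08-16 for the re-typed Statement (p126844: tame genericity on one fixed end, `RaysStayInClosure`, honest radii, `IsFutureOriented`): fix `X` and an exceptional admissible `D`; `AdmissibleMGHDExists` gives an MGHD, so `D` fails the universal clause; either some MGHD has incomplete null infinity (`CensorshipTraceNull`) or all are complete and one fails the re-typed settling clause (`SettlingTraceNull`); either way `D = Φ 0` for a TAME (one fixed end `e`), IMMERSED, injective admissible `k`-probe whose punctured exceptional trace is null dust plus finitely many walls; `LinePiercing` gives a direction `θ ≠ 0` and `ε > 0` with `Φ (t • θ)` good for `0 < |t| < ε` (those data are admissible, hence have MGHDs by `AdmissibleMGHDExists`, hence are NOT exceptional); `TameSegmentToCurve` reparametrises the punctured segment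 to the tame, immersed, injective admissible one-parameter family on the same end `e` through `D` that `IsTameChristodoulouGeneric … 1` demands. Sorry-free (planner Sketch.lean, lean check rc 0; axioms propext, Classical.choice, Quot.sound). -/
@[closes "route-FinalStateConjecture-ProbeNullTrace"] theorem closes (h₁ : CensorshipTraceNull) (h₂ : SettlingTraceNull) (h₃ : AdmissibleMGHDExists)
    (h₄ : LinePiercing) (h₅ : TameSegmentToCurve) : FinalStateConjecture := by
  intro X _ _ _ _ _ _ D hD
  obtain ⟨hDadm, hnotP⟩ := hD
  obtain ⟨𝒟₀, h𝒟₀⟩ := h₃ X D hDadm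
  have key : ∃ (e : Literature.Geometry.Lorentzian.AFEnd X) (k : ℕ) (Φ : EuclideanSpace ℝ (Fin k) → Literature.Geometry.Lorentzian.InitialDataSet (𝓡 3) X), 2 ≤ k ∧ Literature.Geometry.Lorentzian.InitialDataSet.IsTameDataFamily e k Φ ∧ Literature.Geometry.Lorentzian.InitialDataSet.IsImmersedAtZero k Φ ∧ Function.Injective Φ ∧ Φ 0 = D ∧ (∀ c, Φ c ∈ Literature.Geometry.Lorentzian.admissibleVacuumData X) ∧ ∃ (δ : ℝ) (N : Set (EuclideanSpace ℝ (Fin k))) (m : ℕ) (g : Fin m → EuclideanSpace ℝ (Fin k) → ℝ) (L : Fin m → (EuclideanSpace ℝ (Fin k) →L[ℝ] ℝ)), 0 < δ ∧ μH[(k : ℝ) - 1] N = 0 ∧ (∀ i, HasFDerivAt (g i) (L i) 0 ∧ L i ≠ 0) ∧ ∀ c, ‖c‖ < δ → c ≠ 0 → ¬ (∀ 𝒟 : Literature.Geometry.Lorentzian.VacuumCauchyDevelopment (Φ c), 𝒟.IsMaximal → Summit.FinalStateConjecture.HasCompleteNullInfinity 𝒟.toCauchyDevelopment ∧ ∃ (O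 : Set 𝒟.carrier) (d : Literature.Geometry.Lorentzian.FinalStateDecomposition 𝒟.toSpacetime O 2), (∀ i, Literature.Geometry.Lorentzian.Kerr.IsSubextremal (d.mass i) (d.spin i)) ∧ O = Summit.FinalStateConjecture.exteriorOf 𝒟.toCauchyDevelopment d.charted ∧ Summit.FinalStateConjecture.RaysStayInClosure 𝒟.toCauchyDevelopment O ∧ Summit.FinalStateConjecture.HasExhaustiveCharts d ∧ Summit.FinalStateConjecture.IsFutureOriented d) → c ∈ N ∨ ∃ i, g i c = 0 := by
    by_cases hC : ∃ 𝒟 : Literature.Geometry.Lorentzian.VacuumCauchyDevelopment D, 𝒟.IsMaximal ∧ ¬ Summit.FinalStateConjecture.HasCompleteNullInfinity 𝒟.toCauchyDevelopment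
    · exact h₁ X D hDadm hC
    · refine h₂ X D hDadm ?_ ?_
      · intro 𝒟 h𝒟
        by_contra hc
        exact hC ⟨𝒟, h𝒟, hc⟩
      · by_contra hS
        apply hnotP
        refine ⟨⟨𝒟₀, h𝒟₀⟩, fun 𝒟 h𝒟 ↦ ⟨?_, ?_⟩⟩
        · by_contra hc
          exact hC ⟨𝒟, h𝒟, hc⟩
        · by_contra hs
          exact hS ⟨𝒟, h𝒟, hs⟩
  obtain ⟨e, k, Φ, hk, htame, himm, hinj, h0, hadm, δ, N, m, g, L, hδ, hN, hgL, hsub⟩ := key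
  have hTsub : ∀ c ∈ ({c : EuclideanSpace ℝ (Fin k) | ¬ (∀ 𝒟 : Literature.Geometry.Lorentzian.VacuumCauchyDevelopment (Φ c), 𝒟.IsMaximal → Summit.FinalStateConjecture.HasCompleteNullInfinity 𝒟.toCauchyDevelopment ∧ ∃ (O : Set 𝒟.carrier) (d : Literature.Geometry.Lorentzian.FinalStateDecomposition 𝒟.toSpacetime O 2), (∀ i, Literature.Geometry.Lorentzian.Kerr.IsSubextremal (d.mass i) (d.spin i)) ∧ O = Summit.FinalStateConjecture.exteriorOf 𝒟.toCauchyDevelopment d.charted ∧ Summit.FinalStateConjecture.RaysStayInClosure 𝒟.toCauchyDevelopment O ∧ Summit.FinalStateConjecture.HasExhaustiveCharts d ∧ Summit.FinalStateConjecture.IsFutureOriented d)} : Set (EuclideanSpace ℝ (Fin k))), ‖c‖ < δ → c ≠ 0 → c ∈ N ∨ ∃ i, g i c = 0 :=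
    fun c hc hcδ hc0 ↦ hsub c hcδ hc0 hc
  obtain ⟨θ, hθ, ε, hε, hseg⟩ := h₄ k hk _ N δ m g L hδ hN hgL hTsub
  have hgood : ∀ t : ℝ, t ≠ 0 → |t| < ε → Φ (t • θ) ∉ {d ∈ Literature.Geometry.Lorentzian.admissibleVacuumData X | ¬ ((∃ 𝒟 : Literature.Geometry.Lorentzian.VacuumCauchyDevelopment d, 𝒟.IsMaximal) ∧ ∀ 𝒟 : Literature.Geometry.Lorentzian.VacuumCauchyDevelopment d, 𝒟.IsMaximal → Summit.FinalStateConjecture.HasCompleteNullInfinity 𝒟.toCauchyDevelopment ∧ ∃ (O : Set 𝒟.carrier) (d : Literature.Geometry.Lorentzian.FinalStateDecomposition 𝒟.toSpacetime O 2), (∀ i, Literature.Geometry.Lorentzian.Kerr.IsSubextremal (d.mass i) (d.spin i)) ∧ O = Summit.FinalStateConjecture.exteriorOf 𝒟.toCauchyDevelopment d.charted ∧ Summit.FinalStateConjecture.RaysStayInClosure 𝒟.toCauchyDevelopment O ∧ Summit.FinalStateConjecture.HasExhaustiveCharts d ∧ Summit.FinalStateConjecture.IsFutureOriented d)} := by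
    intro t ht htε hmem
    obtain ⟨-, hnP⟩ := hmem
    apply hnP
    refine ⟨h₃ X _ (hadm _), ?_⟩
    by_contra hP'
    exact hseg t ht htε hP'
  obtain ⟨F, hF, hFimm, hF0, hFinj, hFadm, hFgood⟩ :=
    h₅ X (Literature.Geometry.Lorentzian.admissibleVacuumData X) _ e k Φ θ ε htame himm hinj hadm hθ hε hgood
  exact ⟨e, F, hF, hFimm, hF0.trans h0, hFinj, hFadm, hFgood⟩

end Summit.FinalStateConjecture.FinalStateConjecture.Theses.ProbeNullTrace
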